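import Literature.Combinatorics.StablePolynomials.GurvitsCapacityBound
import Literature.Combinatorics.StablePolynomials.ProductLinearForms
import Literature.Combinatorics.Enumerative.PermanentProductForm
import Literature.Barriers.MatrixMultiplication.UnstableTensorBarrierVertex

/-!
# Route SliceSignRank — crux `SignRankSuperQP`, stub `stub_vdwHadamard`
# (the van der Waerden–Hadamard inequality `n! · det(V)² ≤ nⁿ · per(V ∘ V)`)

Route `route-ValiantsHypothesis-SliceSignRank`, crux `SignRankSuperQP` (`stmt-ValiantsHypothesis-15118`),
registered line `Cruxes/SignRankSuperQP/Lines/birth.lean` (Forster transfer; stubs `stub_forsterSlice`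
[the bet] and `stub_vdwHadamard` [provable now]); through the landed `srkNotQP_of_signRankSuperQP`
the same line serves the split child `SrkNotQP` (`stmt-ValiantsHypothesis-20857`). This file proves
the registered stub B verbatim:

  `stub_vdwHadamard : ∀ n (V : Matrix (Fin n) (Fin n) ℝ), n! · det(V)² ≤ nⁿ · per(V ∘ V)`,

where `V ∘ V` is the entrywise square (a nonnegative matrix). Equality holds at flat orthogonal
(Hadamard) `V`. With it the birth line's composition `SignRankSuperQP_of` is closed modulo the single
bet `stub_forsterSlice` (Forster's inequality for the permutation slice).

## Proof (Gurvits + Hadamard, both in the tree; no Sinkhorn scaling)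

Let `B = V ∘ V` and `p_B = ∏_i ∑_j B_ij z_j ∈ ℝ[z]`; its multilinear coefficient is `per B`
(`coeff_prod_rowForms_eq_permanent_fin`), it has nonnegative coefficients and total degree `≤ n`.
* If some row of `B` vanishes, that row of `V` vanishes, `det V = 0`, and the claim is `0 ≤ nⁿ per B`
  (`per` of a nonnegative matrix is nonnegative).
* Otherwise every row form has a positive coefficient, so `p_B` is real stable
  (`isRealStable_linearForm`, `isUpperHalfPlaneStable_prod`). CAPACITY: for `x > 0`, Hadamard's
  inequality for `W = V · diag(√x)` (tree: `Literature.Barriers.MatrixMultiplication.det_sq_le_prod_sum_sq_fin`) reads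
  `det(V)² · ∏_j x_j = det(W)² ≤ ∏_i ∑_j W_ij² = ∏_i ∑_j V_ij² x_j = p_B(x)`, i.e. `Cap(p_B) ≥ det(V)²`.
  Gurvits' capacity theorem (`Gurvits.factorial_mul_le_pow_mul_coeff_one`, Gurvits 2008 §2: for
  `0`-or-real-stable `p` with nonnegative coefficients, degree `≤ n` and `c · ∏ x ≤ p(x)` on `ℝⁿ₊₊`,
  `c · n! ≤ nⁿ · [z₁⋯zₙ] p`) with `c = det(V)²` gives `det(V)² · n! ≤ nⁿ · per B`.

Honest framing: a classical inequality (Egorychev–Falikman–Gurvits + Hadamard) recorded as the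
provable stub of a HELD crux line; the crux `SignRankSuperQP`, its child `SrkNotQP` and the bet
`stub_forsterSlice` remain OPEN; nothing here bears on `VP ≠ VNP`.

## References
* [Gurvits2008] L. Gurvits, *Van der Waerden/Schrijver–Valiant like conjectures and stable
  homogeneous polynomials: one theorem for all*, Electron. J. Combin. 15 (2008) R66, §2.
* [Egorychev1981] G. P. Egorychev, Adv. Math. 42 (1981) 299–305; [Falikman1981] D. I. Falikman,
  Math. Notes 29 (1981) 475–479.
* [HornJohnson2013] R. Horn, C. Johnson, *Matrix Analysis*, 2nd ed., Cor. 7.8.3 (Hadamard).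
-/

-- Sub = Summit layout duplicates the namespace component
set_option linter.dupNamespace false

noncomputable section

namespace Summit.ValiantsHypothesis.ValiantsHypothesis.Theorems.SliceSignRank.SignRankSuperQP

open MvPolynomial Finset Literature.Combinatorics.StablePolynomials

/-- **Capacity of the squared-row-form product is at least `det(V)²`**: for `x > 0`,
`det(V)² · ∏_j x_j ≤ ∏_i ∑_j V_ij² · x_j` — Hadamard's inequality for `V · diag(√x)`. -/
theorem det_sq_mul_prod_le {n : ℕ} (V : Matrix (Fin n) (Fin n) ℝ) (x : Fin n → ℝ)
    (hx : ∀ j, 0 < x j) :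
    V.det ^ 2 * ∏ j, x j ≤ ∏ i, ∑ j, V i j ^ 2 * x j := by
  set W : Matrix (Fin n) (Fin n) ℝ := V * Matrix.diagonal (fun j => Real.sqrt (x j)) with hW
  have hdet : W.det = V.det * ∏ j, Real.sqrt (x j) := by
    rw [hW, Matrix.det_mul, Matrix.det_diagonal]
  have hWij : ∀ i j, W i j = V i j * Real.sqrt (x j) := fun i j => by
    rw [hW, Matrix.mul_diagonal]
  have hsq : ∀ j, Real.sqrt (x j) ^ 2 = x j := fun j => Real.sq_sqrt (hx j).le
  have h := Literature.Barriers.MatrixMultiplication.det_sq_le_prod_sum_sq_fin W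
  rw [hdet, mul_pow, ← Finset.prod_pow] at h
  simp_rw [hWij, mul_pow, hsq] at h
  exact h

/-- The permanent of an entrywise-nonnegative real matrix is nonnegative. [folklore] -/
theorem permanent_nonneg_of_nonneg {n : ℕ} {B : Matrix (Fin n) (Fin n) ℝ} (hB : ∀ i j, 0 ≤ B i j) :
    0 ≤ B.permanent := by
  unfold Matrix.permanent
  exact Finset.sum_nonneg fun σ _ => Finset.prod_nonneg fun i _ => hB _ _

/-- **Stub B of the birth line of crux `SignRankSuperQP` — the van der Waerden–Hadamard inequality**
(registered signature verbatim): for every real `n × n` matrix `V`,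
`n! · det(V)² ≤ nⁿ · per(V ∘ V)`, `V ∘ V` the entrywise square. Proof: Gurvits' capacity bound for
the real stable row-form product `p_{V∘V}` (multilinear coefficient `per(V ∘ V)`) at capacity level
`c = det(V)²`, the capacity estimate being Hadamard's inequality for `V · diag(√x)`; a vanishing row
of `V ∘ V` forces `det V = 0`. [Gurvits2008 §2; Egorychev1981; Falikman1981; HornJohnson2013 Cor. 7.8.3] -/
theorem stub_vdwHadamard :
    ∀ (n : ℕ) (V : Matrix (Fin n) (Fin n) ℝ),
      (n.factorial : ℝ) * V.det ^ 2 ≤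
        (n : ℝ) ^ n * (Matrix.of fun i j => V i j ^ 2).permanent := by
  intro n V
  set B : Matrix (Fin n) (Fin n) ℝ := Matrix.of fun i j => V i j ^ 2 with hB
  have hBij : ∀ i j, B i j = V i j ^ 2 := fun i j => rfl
  have hBnn : ∀ i j, 0 ≤ B i j := fun i j => by rw [hBij]; exact sq_nonneg _
  by_cases hrow : ∀ i, ∃ j, 0 < B i j
  · -- every row form has a positive coefficient: `p_B` is real stable
    have hst : IsRealStable
        (∏ i : Fin n, ∑ j : Fin n, C (B i j) * X j : MvPolynomial (Fin n) ℝ) := by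
      unfold IsRealStable
      rw [map_prod]
      exact isUpperHalfPlaneStable_prod _ fun i _ =>
        isRealStable_linearForm (hBnn i) (hrow i)
    -- capacity `≥ det(V)²`
    have hcap : ∀ x : Fin n → ℝ, (∀ i, 0 < x i) →
        V.det ^ 2 * ∏ i, x i ≤
          MvPolynomial.eval x (∏ i : Fin n, ∑ j : Fin n, C (B i j) * X j : MvPolynomial (Fin n) ℝ) := by
      intro x hx
      rw [eval_prod_rowForms]
      simp_rw [hBij]
      exact det_sq_mul_prod_le V x hx
    have key := Gurvits.factorial_mul_le_pow_mul_coeff_one n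
      (∏ i : Fin n, ∑ j : Fin n, C (B i j) * X j : MvPolynomial (Fin n) ℝ)
      (coeff_prod_rowForms_nonneg hBnn) ((totalDegree_prod_rowForms_le B).trans (by simp))
      (Or.inr hst) (V.det ^ 2) hcap
    rw [Literature.Combinatorics.Enumerative.coeff_prod_rowForms_eq_permanent_fin] at key
    calc (n.factorial : ℝ) * V.det ^ 2 = V.det ^ 2 * (n.factorial : ℝ) := mul_comm _ _
      _ ≤ (n : ℝ) ^ n * B.permanent := key
  · -- some row of `B`, hence of `V`, vanishes: `det V = 0`
    push Not at hrow
    obtain ⟨i, hi⟩ := hrow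
    have hVi : ∀ j, V i j = 0 := fun j => by
      have h0 : B i j = 0 := le_antisymm (hi j) (hBnn i j)
      rw [hBij] at h0
      exact pow_eq_zero_iff (two_ne_zero) |>.1 h0
    have hdet : V.det = 0 := Matrix.det_eq_zero_of_row_eq_zero i hVi
    rw [hdet, zero_pow two_ne_zero, mul_zero]
    exact mul_nonneg (pow_nonneg (Nat.cast_nonneg n) n) (permanent_nonneg_of_nonneg hBnn)

end Summit.ValiantsHypothesis.ValiantsHypothesis.Theorems.SliceSignRank.SignRankSuperQP

end
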